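import Literature.NumberTheory.EllipticCurves.KrizLi2019.SexticTwistBSDThree
import Literature.NumberTheory.QuadraticFields.DedekindZetaReducedForms
import Literature.NumberTheory.QuadraticFields.FundamentalDiscriminant
import Literature.NumberTheory.QuadraticFields.ClassNumberOne
import Literature.NumberTheory.QuadraticFields.ClassNumberLeAbs
import HarnessLib

/-!
# Kriz–Li's `3`-class-number conditions `h₃(D) = 1`, DECIDED IN THE KERNEL for the seven X12 sextic-twist pairs

HONEST FRAMING (cell `b2b-bsdres`, run/shared/lean/b2b/bsd-rank1-residual/; harvest seat
`b2b-bsdres-harvest-1`, gen 4): prove what is provable now; shrink each hard class to its core with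
data; no claim beyond stated classes. The cell deletes the COMBINATION-SHAPED residual classes of
the BSD formula in analytic rank `≤ 1` from PUBLISHED theorems only and TYPES the
construction-shaped ones; this is not "finishing BSD". THEOREMS ONLY (plus one auxiliary `def`, a
sharper search box for reduced forms): no notion redefined, NO new named fact (net debt `0`).

Hypothesis (3) of Kriz–Li, Forum Math. Sigma 7 (2019) e15, Thm. 1.23 = Thm. 10.10 (tree fact
`KrizLi2019.thm1010_bsdThree_overK_sexticTwist`, A48) asks `h₃(D) = 1` — the `3`-part of the class
number of `ℚ(√D)` is trivial — for two integers `D` per pair; the tree states it as the predicate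
`KrizLi2019.ThreeClassNumberTrivial D` ("for every quadratic number field `F` in which `D` is a
square, `3 ∤ h_F`"). In the transports of `Rank1Residual/X12SexticTwistTransport.lean` (p192605 /
p192689) these were per-pair CERTIFICATE VALUES (`h3a`, `h3b`), computed outside the kernel
(harvest-2's `kl/kl_check.py` + PARI `quadclassunit`). This file PROVES all thirteen of them:

`ThreeClassNumberTrivial D` for `D ∈ {−15, −55, −7, −987, −24, −184, −36, −276, −51, −136, −63, −123, −328}`,

by (i) a field `F ∋ √D`, `[F : ℚ] = 2`, has `d_F = d₀`, the fundamental discriminant with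
`D = d₀ m²` (`discr_eq_of_sq_eq`: the order `ℤ[√D]` has discriminant `4D = r² d_F`, tree lemmas
`Quadratic.exists_discr_basisOneSqrt_eq_sq_mul_discr` / `discr_basisOneSqrt_of_quadratic`, and two
fundamental discriminants differing by a rational square are equal,
`Quadratic.eq_of_isFundamental_of_eq_mul_sq` + `isFundamentalDiscriminant_discr`); (ii)
`h_F = h(d_F)` = the number of reduced primitive positive definite forms of discriminant `d_F`
(Cox, Thm. 7.7(ii); tree theorem `Quadratic.card_reducedForms_eq_classNumber`); (iii) the count,
by `decide` over the SHARP search box `a ≤ √(|D|/3)`, `|b| ≤ a` (Cox (2.12);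
`reducedForms_eq_reducedFormsSharp` — the tree's `reducedForms` enumerates `a, |b| ≤ |D|/3`, too
large a box for the kernel at `|D| = 987`): `h(−15) = 2`, `h(−55) = 4`, `h(−7) = 1`, `h(−987) = 8`,
`h(−24) = 2`, `h(−184) = 4`, `h(−4) = 1`, `h(−276) = 8`, `h(−51) = 2`, `h(−136) = 4`, `h(−123) = 2`,
`h(−328) = 4` — none divisible by `3`. (The same values as harvest-2's two engines, KL19-X12-SEXTIC.md §3/§7.)

## References
* [KrizLi2019] D. Kriz, C. Li, Forum Math. Sigma 7 (2019) e15, Thm. 1.23 (hypothesis (3), notation `h₃(D)`).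
* [Cox2013] D. A. Cox, *Primes of the form x² + ny²*, 2nd ed., §2.A (2.7), (2.12), Thm. 2.13; §7.B Thm. 7.7(ii).
* [Marcus1977] D. A. Marcus, *Number Fields*, Ch. 2, Thm. 1 and Exercise 27(c) (discriminants of quadratic orders).
-/

open scoped Classical

open Module NumberField
open Literature.NumberTheory.QuadraticFields Literature.NumberTheory.QuadraticFields.Quadratic
open Literature.NumberTheory.QuadraticFields.BinaryQuadraticForm

namespace Literature.NumberTheory.QuadraticFields.BinaryQuadraticForm

/-! ### §1. A sharper (kernel-sized) search box for the reduced forms of discriminant `D` -/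

/-- The reduced primitive positive definite forms of discriminant `D` enumerated over the box
`1 ≤ a ≤ A`, `|b| ≤ A` (same filter and image as the tree's `reducedForms`, whose box is `|D|/3`);
for `3(A+1)² > |D|` it IS `reducedForms D` (`reducedForms_eq_reducedFormsSharp`, Cox (2.12):
a reduced form has `3a² ≤ |D|`). [cite: Cox2013, §2.A (2.12)] -/
noncomputable def reducedFormsSharp (D : ℤ) (A : ℕ) : Finset (ℤ × ℤ × ℤ) :=
  (((Finset.Icc (1 : ℤ) A) ×ˢ (Finset.Icc (-(A : ℤ)) A)).filter
      (fun ab => 4 * ab.1 ∣ ab.2 ^ 2 - D ∧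
        IsPrimitive (ab.1, ab.2, (ab.2 ^ 2 - D) / (4 * ab.1)) ∧
        IsReduced (ab.1, ab.2, (ab.2 ^ 2 - D) / (4 * ab.1)))).image
    (fun ab => (ab.1, ab.2, (ab.2 ^ 2 - D) / (4 * ab.1)))

/-- Membership in the sharp box: for `3(A+1)² > −D`, `Q ∈ reducedFormsSharp D A` iff
`Q` is a reduced primitive positive definite form of discriminant `D` (as `mem_reducedForms_iff`).
[cite: Cox2013, §2.A (2.12) and Thm. 2.13] -/
theorem mem_reducedFormsSharp_iff {D : ℤ} {A : ℕ} (hA : -D < 3 * ((A : ℤ) + 1) ^ 2)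
    {Q : ℤ × ℤ × ℤ} :
    Q ∈ reducedFormsSharp D A ↔ discr Q = D ∧ 0 < Q.1 ∧ IsPrimitive Q ∧ IsReduced Q := by
  constructor
  · intro hQ
    simp only [reducedFormsSharp, Finset.mem_image, Finset.mem_filter, Finset.mem_product,
      Finset.mem_Icc] at hQ
    obtain ⟨⟨a, b⟩, ⟨⟨⟨ha1, -⟩, -⟩, hdvd, hprim, hred⟩, rfl⟩ := hQ
    simp only at ha1 hdvd hprim hred ⊢
    refine ⟨?_, by omega, hprim, hred⟩
    rw [discr_apply, Int.mul_ediv_cancel' hdvd]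
    ring
  · rintro ⟨hdisc, ha, hprim, hred⟩
    obtain ⟨a, b, c⟩ := Q
    simp only at ha
    obtain ⟨-, hb1, hb2, hac⟩ := le_of_isReduced hdisc ha hred
    have h3 := three_mul_sq_le_of_isReduced hdisc ha hred
    have h4a : (4 * a : ℤ) ≠ 0 := by omega
    have hc : (b ^ 2 - D) / (4 * a) = c := by
      rw [← hdisc, discr_apply, show b ^ 2 - (b ^ 2 - 4 * a * c) = 4 * a * c by ring,
        Int.mul_ediv_cancel_left _ h4a]
    have hbound : a ≤ (A : ℤ) := by
      by_contra hlt
      rw [not_le] at hlt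
      have hsq : ((A : ℤ) + 1) ^ 2 ≤ a ^ 2 := by nlinarith
      linarith
    simp only [reducedFormsSharp, Finset.mem_image, Finset.mem_filter, Finset.mem_product,
      Finset.mem_Icc]
    refine ⟨(a, b), ⟨⟨⟨by omega, hbound⟩, by omega, by omega⟩, ?_, ?_, ?_⟩, ?_⟩
    · rw [← hdisc, discr_apply, show b ^ 2 - (b ^ 2 - 4 * a * c) = (4 * a) * c by ring]
      exact dvd_mul_right _ _
    · simpa only [hc] using hprim
    · simpa only [hc] using hred
    · simp only [hc]

/-- **The sharp box computes `reducedForms D`** when `3(A+1)² > −D`. [cite: Cox2013, §2.A (2.12)] -/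
theorem reducedForms_eq_reducedFormsSharp {D : ℤ} (hD : D < 0) {A : ℕ}
    (hA : -D < 3 * ((A : ℤ) + 1) ^ 2) : reducedForms D = reducedFormsSharp D A := by
  ext Q
  rw [mem_reducedForms_iff hD, mem_reducedFormsSharp_iff hA]

end Literature.NumberTheory.QuadraticFields.BinaryQuadraticForm

namespace Literature.NumberTheory.EllipticCurves.KrizLi2019

/-! ### §2. The discriminant of a quadratic field containing `√D` -/

/-- **`d_F = d₀` for a quadratic field `F ∋ √D`, `D = d₀ m² < 0` with `d₀` fundamental.** The
element `√D` is integral and irrational (`D < 0`), `disc(1, √D) = 4D = r²·d_F` (Marcus, Ch. 2,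
Exercise 27(c); tree `exists_discr_basisOneSqrt_eq_sq_mul_discr`, `discr_basisOneSqrt_of_quadratic`),
so `d_F = d₀ (2m/r)²`, and two fundamental discriminants that differ by a rational square coincide
(`eq_of_isFundamental_of_eq_mul_sq`, `isFundamentalDiscriminant_discr`). [cite: Marcus1977, Ch. 2 Thm. 1 and Exercise 27(c)] -/
theorem discr_eq_of_sq_eq {F : Type*} [Field F] [NumberField F] (h2 : finrank ℚ F = 2)
    {D d₀ m : ℤ}
    (hfund : (d₀ % 4 = 1 ∧ Squarefree d₀ ∧ d₀ ≠ 1) ∨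
      (4 ∣ d₀ ∧ (d₀ / 4 % 4 = 2 ∨ d₀ / 4 % 4 = 3) ∧ Squarefree (d₀ / 4)))
    (hDm : D = d₀ * m ^ 2) (hD : D < 0) {x : F} (hx : x ^ 2 = (D : F)) :
    NumberField.discr F = d₀ := by
  have hint : IsIntegral ℤ x := isIntegral_of_sq_eq_intCast hx
  have hθ : x ∉ Set.range (algebraMap ℚ F) := by
    rintro ⟨q, hq⟩
    have h' : algebraMap ℚ F (q ^ 2) = algebraMap ℚ F (D : ℚ) := by
      rw [map_pow, hq, hx, map_intCast]
    have hq2 : q ^ 2 = (D : ℚ) := (algebraMap ℚ F).injective h'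
    have hD' : (D : ℚ) < 0 := by exact_mod_cast hD
    nlinarith [sq_nonneg q]
  obtain ⟨r, hr0, hr⟩ := exists_discr_basisOneSqrt_eq_sq_mul_discr h2 hθ hint
  have hrel : x ^ 2 + algebraMap ℚ F 0 * x + algebraMap ℚ F (-(D : ℚ)) = 0 := by
    rw [hx, map_zero, zero_mul, add_zero, map_neg, map_intCast, add_neg_cancel]
  rw [discr_basisOneSqrt_of_quadratic h2 hθ hrel] at hr
  have hr0' : (r : ℚ) ≠ 0 := by exact_mod_cast hr0
  have hDm' : (D : ℚ) = d₀ * (m : ℚ) ^ 2 := by exact_mod_cast hDm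
  refine eq_of_isFundamental_of_eq_mul_sq (isFundamentalDiscriminant_discr h2) hfund
    (q := 2 * m / r) ?_
  field_simp
  linear_combination (-1 : ℚ) * hr + 4 * hDm'

/-- **`h₃(D) = 1` from a reduced-forms count.** If `D = d₀ m² < 0` with `d₀` fundamental, and the
number `n` of reduced primitive positive definite forms of discriminant `d₀` (counted in the sharp
box) is prime to `3`, then `ThreeClassNumberTrivial D`: every quadratic `F ∋ √D` has `d_F = d₀`
(`discr_eq_of_sq_eq`) and `h_F = h(d₀) = n` (Cox Thm. 7.7(ii), tree `card_reducedForms_eq_classNumber`).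
[cite: Cox2013, §7.B Thm. 7.7(ii)] [cite: KrizLi2019, Thm. 1.23 (3)] -/
theorem threeClassNumberTrivial_of_card {D d₀ m : ℤ} (A n : ℕ)
    (hfund : (d₀ % 4 = 1 ∧ Squarefree d₀ ∧ d₀ ≠ 1) ∨
      (4 ∣ d₀ ∧ (d₀ / 4 % 4 = 2 ∨ d₀ / 4 % 4 = 3) ∧ Squarefree (d₀ / 4)))
    (hm : m ≠ 0) (hDm : D = d₀ * m ^ 2) (hd₀ : d₀ < 0) (hA : -d₀ < 3 * ((A : ℤ) + 1) ^ 2)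
    (hcard : (reducedFormsSharp d₀ A).card = n) (h3 : ¬ 3 ∣ n) : ThreeClassNumberTrivial D := by
  intro F _ _ h2 hx
  obtain ⟨x, hx⟩ := hx
  have hm2 : 0 < m ^ 2 := by positivity
  have hD : D < 0 := by rw [hDm]; nlinarith
  have hdisc := discr_eq_of_sq_eq h2 hfund hDm hD hx
  rw [← card_reducedForms_eq_classNumber h2 (by rw [hdisc]; exact hd₀), hdisc,
    BinaryQuadraticForm.classNumber, reducedForms_eq_reducedFormsSharp hd₀ hA, hcard]
  exact h3

/-! ### §3. The thirteen values (`decide` over the sharp box; squarefreeness from primality) -/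

/-- `Squarefree (−n)` in `ℤ` from `Squarefree n` in `ℕ`. [folklore] -/
theorem squarefree_neg_natCast {n : ℕ} (h : Squarefree n) : Squarefree (-(n : ℤ)) :=
  Int.squarefree_natAbs.mp (by simpa using h)

/-- `Squarefree (p q)` for distinct primes. [folklore] -/
theorem squarefree_mul_of_prime {p q : ℕ} (hp : p.Prime) (hq : q.Prime) (hpq : p ≠ q) :
    Squarefree (p * q) :=
  (Nat.squarefree_mul ((Nat.coprime_primes hp hq).mpr hpq)).mpr ⟨hp.squarefree, hq.squarefree⟩

/-- `Squarefree (p q r)` for distinct primes. [folklore] -/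
theorem squarefree_mul_mul_of_prime {p q r : ℕ} (hp : p.Prime) (hq : q.Prime) (hr : r.Prime)
    (hpq : p ≠ q) (hpr : p ≠ r) (hqr : q ≠ r) : Squarefree (p * q * r) :=
  (Nat.squarefree_mul (Nat.Coprime.mul_left ((Nat.coprime_primes hp hr).mpr hpr)
      ((Nat.coprime_primes hq hr).mpr hqr))).mpr
    ⟨squarefree_mul_of_prime hp hq hpq, hr.squarefree⟩

/-- `h(−15) = 2` ⇒ `h₃(−15) = 1`. [cite: Cox2013, §2.A Thm. 2.13 and §7.B Thm. 7.7(ii)] -/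
theorem threeClassNumberTrivial_neg15 : ThreeClassNumberTrivial (-15) :=
  threeClassNumberTrivial_of_card (d₀ := -15) (m := 1) 2 2
    (Or.inl ⟨by decide, by simpa using squarefree_neg_natCast (squarefree_mul_of_prime Nat.prime_three Nat.prime_five (by decide)), by decide⟩)
    one_ne_zero (by norm_num) (by norm_num) (by norm_num) (by decide +kernel) (by decide)

/-- `h(−55) = 4` ⇒ `h₃(−55) = 1`. [cite: Cox2013, §2.A Thm. 2.13 and §7.B Thm. 7.7(ii)] -/
theorem threeClassNumberTrivial_neg55 : ThreeClassNumberTrivial (-55) :=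
  threeClassNumberTrivial_of_card (d₀ := -55) (m := 1) 4 4
    (Or.inl ⟨by decide, by simpa using squarefree_neg_natCast (squarefree_mul_of_prime Nat.prime_five (by norm_num : Nat.Prime 11) (by decide)), by decide⟩)
    one_ne_zero (by norm_num) (by norm_num) (by norm_num) (by decide +kernel) (by decide)

/-- `h(−7) = 1` ⇒ `h₃(−7) = 1`. [cite: Cox2013, §2.A Thm. 2.13 and §7.B Thm. 7.7(ii)] -/
theorem threeClassNumberTrivial_neg7 : ThreeClassNumberTrivial (-7) :=
  threeClassNumberTrivial_of_card (d₀ := -7) (m := 1) 1 1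
    (Or.inl ⟨by decide, by simpa using squarefree_neg_natCast (by norm_num : Nat.Prime 7).squarefree, by decide⟩)
    one_ne_zero (by norm_num) (by norm_num) (by norm_num) (by decide +kernel) (by decide)

/-- `h(−987) = 8` (`987 = 3·7·47`; sharp box `a ≤ 18`) ⇒ `h₃(−987) = 1`. [cite: Cox2013, §2.A Thm. 2.13 and §7.B Thm. 7.7(ii)] -/
theorem threeClassNumberTrivial_neg987 : ThreeClassNumberTrivial (-987) :=
  threeClassNumberTrivial_of_card (d₀ := -987) (m := 1) 18 8
    (Or.inl ⟨by decide, by simpa using squarefree_neg_natCast (squarefree_mul_mul_of_prime Nat.prime_three (by norm_num : Nat.Prime 7) (by norm_num : Nat.Prime 47) (by decide) (by decide) (by decide)), by decide⟩)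
    one_ne_zero (by norm_num) (by norm_num) (by norm_num) (by decide +kernel) (by decide)

/-- `h(−24) = 2` ⇒ `h₃(−24) = 1`. [cite: Cox2013, §2.A Thm. 2.13 and §7.B Thm. 7.7(ii)] -/
theorem threeClassNumberTrivial_neg24 : ThreeClassNumberTrivial (-24) :=
  threeClassNumberTrivial_of_card (d₀ := -24) (m := 1) 2 2
    (Or.inr ⟨by decide, by decide, by
      rw [show ((-24 : ℤ) / 4) = -6 by norm_num]
      simpa using squarefree_neg_natCast (squarefree_mul_of_prime Nat.prime_two Nat.prime_three (by decide))⟩)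
    one_ne_zero (by norm_num) (by norm_num) (by norm_num) (by decide +kernel) (by decide)

/-- `h(−184) = 4` (`−184 = 4·(−46)`) ⇒ `h₃(−184) = 1`. [cite: Cox2013, §2.A Thm. 2.13 and §7.B Thm. 7.7(ii)] -/
theorem threeClassNumberTrivial_neg184 : ThreeClassNumberTrivial (-184) :=
  threeClassNumberTrivial_of_card (d₀ := -184) (m := 1) 7 4
    (Or.inr ⟨by decide, by decide, by
      rw [show ((-184 : ℤ) / 4) = -46 by norm_num]
      simpa using squarefree_neg_natCast (squarefree_mul_of_prime Nat.prime_two (by norm_num : Nat.Prime 23) (by decide))⟩)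
    one_ne_zero (by norm_num) (by norm_num) (by norm_num) (by decide +kernel) (by decide)

/-- `h(−4) = 1` and `−36 = −4·3²` ⇒ `h₃(−36) = 1` (the field is `ℚ(i)`). [cite: Cox2013, §2.A Thm. 2.13 and §7.B Thm. 7.7(ii)] -/
theorem threeClassNumberTrivial_neg36 : ThreeClassNumberTrivial (-36) :=
  threeClassNumberTrivial_of_card (d₀ := -4) (m := 3) 1 1
    (Or.inr ⟨by decide, by decide, by
      rw [show ((-4 : ℤ) / 4) = -1 by norm_num]
      exact isUnit_one.neg.squarefree⟩)
    (by norm_num) (by norm_num) (by norm_num) (by norm_num) (by decide +kernel) (by decide)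

/-- `h(−276) = 8` (`−276 = 4·(−69)`) ⇒ `h₃(−276) = 1`. [cite: Cox2013, §2.A Thm. 2.13 and §7.B Thm. 7.7(ii)] -/
theorem threeClassNumberTrivial_neg276 : ThreeClassNumberTrivial (-276) :=
  threeClassNumberTrivial_of_card (d₀ := -276) (m := 1) 9 8
    (Or.inr ⟨by decide, by decide, by
      rw [show ((-276 : ℤ) / 4) = -69 by norm_num]
      simpa using squarefree_neg_natCast (squarefree_mul_of_prime Nat.prime_three (by norm_num : Nat.Prime 23) (by decide))⟩)
    one_ne_zero (by norm_num) (by norm_num) (by norm_num) (by decide +kernel) (by decide)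

/-- `h(−51) = 2` ⇒ `h₃(−51) = 1`. [cite: Cox2013, §2.A Thm. 2.13 and §7.B Thm. 7.7(ii)] -/
theorem threeClassNumberTrivial_neg51 : ThreeClassNumberTrivial (-51) :=
  threeClassNumberTrivial_of_card (d₀ := -51) (m := 1) 4 2
    (Or.inl ⟨by decide, by simpa using squarefree_neg_natCast (squarefree_mul_of_prime Nat.prime_three (by norm_num : Nat.Prime 17) (by decide)), by decide⟩)
    one_ne_zero (by norm_num) (by norm_num) (by norm_num) (by decide +kernel) (by decide)

/-- `h(−136) = 4` (`−136 = 4·(−34)`) ⇒ `h₃(−136) = 1`. [cite: Cox2013, §2.A Thm. 2.13 and §7.B Thm. 7.7(ii)] -/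
theorem threeClassNumberTrivial_neg136 : ThreeClassNumberTrivial (-136) :=
  threeClassNumberTrivial_of_card (d₀ := -136) (m := 1) 6 4
    (Or.inr ⟨by decide, by decide, by
      rw [show ((-136 : ℤ) / 4) = -34 by norm_num]
      simpa using squarefree_neg_natCast (squarefree_mul_of_prime Nat.prime_two (by norm_num : Nat.Prime 17) (by decide))⟩)
    one_ne_zero (by norm_num) (by norm_num) (by norm_num) (by decide +kernel) (by decide)

/-- `h(−7) = 1` and `−63 = −7·3²` ⇒ `h₃(−63) = 1` (the field is `ℚ(√−7)`). [cite: Cox2013, §2.A Thm. 2.13 and §7.B Thm. 7.7(ii)] -/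
theorem threeClassNumberTrivial_neg63 : ThreeClassNumberTrivial (-63) :=
  threeClassNumberTrivial_of_card (d₀ := -7) (m := 3) 1 1
    (Or.inl ⟨by decide, by simpa using squarefree_neg_natCast (by norm_num : Nat.Prime 7).squarefree, by decide⟩)
    (by norm_num) (by norm_num) (by norm_num) (by norm_num) (by decide +kernel) (by decide)

/-- `h(−123) = 2` ⇒ `h₃(−123) = 1`. [cite: Cox2013, §2.A Thm. 2.13 and §7.B Thm. 7.7(ii)] -/
theorem threeClassNumberTrivial_neg123 : ThreeClassNumberTrivial (-123) :=
  threeClassNumberTrivial_of_card (d₀ := -123) (m := 1) 6 2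
    (Or.inl ⟨by decide, by simpa using squarefree_neg_natCast (squarefree_mul_of_prime Nat.prime_three (by norm_num : Nat.Prime 41) (by decide)), by decide⟩)
    one_ne_zero (by norm_num) (by norm_num) (by norm_num) (by decide +kernel) (by decide)

/-- `h(−328) = 4` (`−328 = 4·(−82)`) ⇒ `h₃(−328) = 1`. [cite: Cox2013, §2.A Thm. 2.13 and §7.B Thm. 7.7(ii)] -/
theorem threeClassNumberTrivial_neg328 : ThreeClassNumberTrivial (-328) :=
  threeClassNumberTrivial_of_card (d₀ := -328) (m := 1) 10 4
    (Or.inr ⟨by decide, by decide, by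
      rw [show ((-328 : ℤ) / 4) = -82 by norm_num]
      simpa using squarefree_neg_natCast (squarefree_mul_of_prime Nat.prime_two (by norm_num : Nat.Prime 41) (by decide))⟩)
    one_ne_zero (by norm_num) (by norm_num) (by norm_num) (by decide +kernel) (by decide)

end Literature.NumberTheory.EllipticCurves.KrizLi2019
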